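import Summits.KontsevichZagierPeriods.KontsevichZagierPeriods.Theorems.HyperbolicBlochOffTetraSectorKernelGlue
import Summits.KontsevichZagierPeriods.KontsevichZagierPeriods.Theorems.HyperbolicBlochOffTetraSectorKernelPolytopeEnvelopeMain
import Summits.KontsevichZagierPeriods.KontsevichZagierPeriods.Theorems.HyperbolicBlochOffTetraSectorKernelStubRungTwoNormalForm
import Summits.KontsevichZagierPeriods.KontsevichZagierPeriods.Theorems.HyperbolicBlochOffTetraSectorKernelStubFloorCandidatesFinite
import Summits.KontsevichZagierPeriods.KontsevichZagierPeriods.Theorems.HyperbolicBlochOffTetraSectorKernelStubFloorDivergence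
import Summits.KontsevichZagierPeriods.KontsevichZagierPeriods.Theorems.HyperbolicBlochOffTetraSectorKernelStubFloorClearance
import Summits.KontsevichZagierPeriods.KontsevichZagierPeriods.Theorems.HyperbolicBlochOffTetraSectorKernelStubMeshCover
import Summits.KontsevichZagierPeriods.KontsevichZagierPeriods.Theorems.HyperbolicBlochOffTetraSectorKernelStubSimplexCut
import Summits.KontsevichZagierPeriods.KontsevichZagierPeriods.Theorems.HyperbolicBlochOffTetraSectorKernelTetraSubsetRungTwo
import Summits.KontsevichZagierPeriods.KontsevichZagierPeriods.Theorems.HyperbolicBlochOffTetraSectorKernelStubRungZero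
import Summits.KontsevichZagierPeriods.KontsevichZagierPeriods.Theorems.HyperbolicBlochOffTetraSectorKernelRungOne
import Summits.KontsevichZagierPeriods.KontsevichZagierPeriods.Theses.HyperbolicBloch
import Literature.NumberTheory.Transcendental.KZHyperbolicLadder
import Summits.KontsevichZagierPeriods.KontsevichZagierPeriods.Theorems.HyperbolicBlochOffTetraSectorKernelLadderFamilyExists
import Literature.NumberTheory.Transcendental.KZLogCalculusProofs

/-!
# Rung 2 of the hyperbolic scissors ladder is the Bloch–Wigner sector — crux `OffTetraSectorKernel` (v5, lead c3)

`rungTwo_le : closure (KZ.rungRelators 2) ≤ KZ.relations ⊔ closure (tetrahedral value-relators)`: every `ℤ`-linear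
relation among hyperbolic volumes of finite-volume `ℚ̄`-geodesic polytopes of `ℍ³` is, modulo the Kontsevich–Zagier
moves, a relation among Bloch–Wigner values — the polytope half of Dupont–Sah's "ideal simplices generate `P(H̄³)`"
inside the calculus. Composition of the six landed v5 stubs with the lead's `stub_polytopeEnvelope` and the envelope
principle `offTetraSectorKernel_on_envelope` (lead 0). Together with `tetraRelators_subset_relations_sup_rungTwo`
(lead c1's stub, landed) the two oracles `closure(tetra)` and `closure(rungRelators 2)` agree modulo `relations`.

References: J. L. Dupont, C.-H. Sah, *Scissors congruences II* (1982), §3.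
-/

noncomputable section

open Set MeasureTheory
open Literature.NumberTheory.Transcendental

namespace Summit.KontsevichZagierPeriods.HyperbolicBloch.OffTetraSectorKernel

/-- **Rung 2 of the ladder is the Bloch–Wigner sector**: every `ℤ`-value-relator among volumes of finite-volume
`ℚ̄`-geodesic polytopes of `ℍ³` lies in `relations ⊔ closure (tetrahedral value-relators)` (polytope envelope + the
envelope principle `offTetraSectorKernel_on_envelope`). [cite: DupontSah1982, §3] -/
theorem rungTwo_le :
    ∀ (T : ℂ → Set (Fin 3 → ℝ)), (∀ z, T z = {p | 0 < p 1 ∧ z.re * p 1 < z.im * p 0 ∧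
      z.im * (p 0 - 1) < (z.re - 1) * p 1 ∧ 0 < p 2 ∧
      0 < z.im * (p 0 ^ 2 + p 1 ^ 2 + p 2 ^ 2 - p 0) + (z.re - Complex.normSq z) * p 1}) →
    AddSubgroup.closure (KZ.rungRelators 2) ≤
      KZ.relations ⊔ AddSubgroup.closure {d : KZ.FormalRep | ∃ ρ : ℂ → KZ.IntegralRep 3,
          (∀ z, IsAlgebraic ℚ z → 0 < z.im → (ρ z).domain = T z ∧
            Set.EqOn (ρ z).integrand (fun p => 1 / p 2 ^ 3) (T z)) ∧
          ∃ (k : ℕ) (z : Fin k → ℂ) (n : Fin k → ℤ), (∀ i, IsAlgebraic ℚ (z i)) ∧ (∀ i, 0 < (z i).im) ∧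
            ∑ i, (n i : ℝ) * (ρ (z i)).value = 0 ∧ d = ∑ i, n i • KZ.of (ρ (z i))} := by
  intro T hT
  classical
  have hTe : T = idealTetrahedron := funext fun z => (hT z).trans rfl
  subst hTe
  obtain ⟨ρ₀, hρ₀⟩ := exists_tetraFamily
  have hdens : ∀ p : Fin 3 → ℝ, KZ.hypDensity 2 p = 1 / p 2 ^ 3 := fun p => by
    simp [KZ.hypDensity, Fin.last]
  have henv := stub_polytopeEnvelope (fun p => ![p 0 ^ 2 + p 1 ^ 2 + p 2 ^ 2, p 0, p 1, 1]) (fun _ => rfl)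
    (fun v => {p | 0 < p 2 ∧ ∀ a, 0 < (Matrix.of v).det *
      ((Matrix.of v).updateRow a ((fun p : Fin 3 → ℝ => ![p 0 ^ 2 + p 1 ^ 2 + p 2 ^ 2, p 0, p 1, 1]) p)).det})
    (fun _ => rfl) ρ₀ hρ₀ (stub_rungTwoNormalForm _ (fun _ => rfl)) stub_floorCandidatesFinite
    (stub_floorDivergence _ (fun _ => rfl))
    (stub_floorClearance _ (fun _ => rfl) (stub_floorDivergence _ (fun _ => rfl)))
    (stub_meshCover _ (fun _ => rfl) _ (fun _ => rfl)) (stub_simplexCut _ (fun _ => rfl) _ (fun _ => rfl))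
  refine (AddSubgroup.closure_le _).mpr ?_
  rintro d ⟨ρ₂, hρ₂, k, P, m, hP, hsum, rfl⟩
  have hmem : ∑ i, m i • KZ.of (ρ₂ (P i)) ∈ AddSubgroup.closure {x : KZ.FormalRep |
      ∃ (k : ℕ) (z : Fin k → ℂ) (e : Fin k → ℤ), (∀ i, IsAlgebraic ℚ (z i)) ∧ (∀ i, 0 < (z i).im) ∧
        x - ∑ i, e i • KZ.of (ρ₀ (z i)) ∈ KZ.relations} :=
    sum_mem fun i _ => zsmul_mem (henv (P i) (hP i) (ρ₂ (P i)) (hρ₂ (P i) (hP i)).1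
      (fun p hp => by rw [(hρ₂ (P i) (hP i)).2 hp, hdens])) _
  have h0 : KZ.eval (∑ i, m i • KZ.of (ρ₂ (P i))) = 0 := by
    simpa [map_sum, map_zsmul, KZ.eval_of, zsmul_eq_mul] using hsum
  exact offTetraSectorKernel_on_envelope idealTetrahedron ρ₀ hρ₀ hmem h0

/-- **The two oracles agree**: modulo the Kontsevich–Zagier moves, the tetrahedral value-relators and the value-relators
of the whole rung 2 of the ladder generate the same subgroup (`rungTwo_le` + lead c1's
`tetraRelators_subset_relations_sup_rungTwo`). [cite: DupontSah1982, §3] -/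
theorem relations_sup_closure_rungTwo_eq :
    ∀ (T : ℂ → Set (Fin 3 → ℝ)), (∀ z, T z = {p | 0 < p 1 ∧ z.re * p 1 < z.im * p 0 ∧
      z.im * (p 0 - 1) < (z.re - 1) * p 1 ∧ 0 < p 2 ∧
      0 < z.im * (p 0 ^ 2 + p 1 ^ 2 + p 2 ^ 2 - p 0) + (z.re - Complex.normSq z) * p 1}) →
    KZ.relations ⊔ AddSubgroup.closure {d : KZ.FormalRep | ∃ ρ : ℂ → KZ.IntegralRep 3,
          (∀ z, IsAlgebraic ℚ z → 0 < z.im → (ρ z).domain = T z ∧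
            Set.EqOn (ρ z).integrand (fun p => 1 / p 2 ^ 3) (T z)) ∧
          ∃ (k : ℕ) (z : Fin k → ℂ) (n : Fin k → ℤ), (∀ i, IsAlgebraic ℚ (z i)) ∧ (∀ i, 0 < (z i).im) ∧
            ∑ i, (n i : ℝ) * (ρ (z i)).value = 0 ∧ d = ∑ i, n i • KZ.of (ρ (z i))} =
      KZ.relations ⊔ AddSubgroup.closure (KZ.rungRelators 2) := by
  intro T hT
  refine le_antisymm (sup_le le_sup_left ((AddSubgroup.closure_le _).mpr fun d hd => ?_))
    (sup_le le_sup_left (rungTwo_le T hT))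
  exact tetraRelators_subset_relations_sup_rungTwo T hT d hd

/-- **The ladder below `ℍ⁵` adds nothing to the Bloch–Wigner oracle**: rungs 0, 1, 2 together are absorbed by
`relations ⊔ closure (tetra)`. [cite: Goncharov1999, §1.7] -/
theorem closure_lowRungs_le :
    ∀ (T : ℂ → Set (Fin 3 → ℝ)), (∀ z, T z = {p | 0 < p 1 ∧ z.re * p 1 < z.im * p 0 ∧
      z.im * (p 0 - 1) < (z.re - 1) * p 1 ∧ 0 < p 2 ∧
      0 < z.im * (p 0 ^ 2 + p 1 ^ 2 + p 2 ^ 2 - p 0) + (z.re - Complex.normSq z) * p 1}) →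
    AddSubgroup.closure (KZ.rungRelators 0 ∪ KZ.rungRelators 1 ∪ KZ.rungRelators 2) ≤
      KZ.relations ⊔ AddSubgroup.closure {d : KZ.FormalRep | ∃ ρ : ℂ → KZ.IntegralRep 3,
          (∀ z, IsAlgebraic ℚ z → 0 < z.im → (ρ z).domain = T z ∧
            Set.EqOn (ρ z).integrand (fun p => 1 / p 2 ^ 3) (T z)) ∧
          ∃ (k : ℕ) (z : Fin k → ℂ) (n : Fin k → ℤ), (∀ i, IsAlgebraic ℚ (z i)) ∧ (∀ i, 0 < (z i).im) ∧
            ∑ i, (n i : ℝ) * (ρ (z i)).value = 0 ∧ d = ∑ i, n i • KZ.of (ρ (z i))} := by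
  intro T hT
  refine (AddSubgroup.closure_le _).mpr ?_
  rintro d ((hd | hd) | hd)
  · exact AddSubgroup.mem_sup_left (stub_rungZero hd)
  · exact AddSubgroup.mem_sup_left (rungOne_subset hd)
  · exact rungTwo_le T hT (AddSubgroup.subset_closure hd)

/-- **The residue is exactly Conjecture 1 off the Bloch–Wigner sector**: adjoining the three low rungs of the ladder
to the crux's oracle does not change it. [cite: KontsevichZagier2001, §1.2] -/
theorem offTetraSectorKernel_iff_offLowRungs :
    Summit.KontsevichZagierPeriods.KontsevichZagierPeriods.Theses.HyperbolicBloch.OffTetraSectorKernel ↔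
    ∀ (T : ℂ → Set (Fin 3 → ℝ)), (∀ z, T z = {p | 0 < p 1 ∧ z.re * p 1 < z.im * p 0 ∧
      z.im * (p 0 - 1) < (z.re - 1) * p 1 ∧ 0 < p 2 ∧
      0 < z.im * (p 0 ^ 2 + p 1 ^ 2 + p 2 ^ 2 - p 0) + (z.re - Complex.normSq z) * p 1}) →
    ∀ c : KZ.FormalRep, KZ.eval c = 0 →
      c ∈ KZ.relations ⊔ AddSubgroup.closure {d : KZ.FormalRep | ∃ ρ : ℂ → KZ.IntegralRep 3,
          (∀ z, IsAlgebraic ℚ z → 0 < z.im → (ρ z).domain = T z ∧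
            Set.EqOn (ρ z).integrand (fun p => 1 / p 2 ^ 3) (T z)) ∧
          ∃ (k : ℕ) (z : Fin k → ℂ) (n : Fin k → ℤ), (∀ i, IsAlgebraic ℚ (z i)) ∧ (∀ i, 0 < (z i).im) ∧
            ∑ i, (n i : ℝ) * (ρ (z i)).value = 0 ∧ d = ∑ i, n i • KZ.of (ρ (z i))} ⊔
        AddSubgroup.closure (KZ.rungRelators 0 ∪ KZ.rungRelators 1 ∪ KZ.rungRelators 2) := by
  constructor
  · intro h T hT c hc
    exact AddSubgroup.mem_sup_left (h T hT c hc)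
  · intro h T hT c hc
    exact sup_le le_rfl (closure_lowRungs_le T hT) (h T hT c hc)


/-- **Hilbert's third problem for `ℚ̄`-geodesic polytopes of `ℍ³`, modulo the Bloch–Wigner oracle**: two Kontsevich–Zagier
representations `[P, t⁻³]`, `[P', t⁻³]` of the volumes of finite-volume `ℚ̄`-geodesic polytopes with the SAME volume differ
by an element of `relations ⊔ closure (tetrahedral value-relators)` (a two-term instance of `rungTwo_le`).
[cite: DupontSah1982, §3] -/
theorem sub_mem_sup_closure_of_volume_eq :
    ∀ (T : ℂ → Set (Fin 3 → ℝ)), (∀ z, T z = {p | 0 < p 1 ∧ z.re * p 1 < z.im * p 0 ∧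
      z.im * (p 0 - 1) < (z.re - 1) * p 1 ∧ 0 < p 2 ∧
      0 < z.im * (p 0 ^ 2 + p 1 ^ 2 + p 2 ^ 2 - p 0) + (z.re - Complex.normSq z) * p 1}) →
    ∀ {P P' : Set (Fin 3 → ℝ)}, KZ.IsGeodesicPolytope 2 P → KZ.IsGeodesicPolytope 2 P' →
    ∀ (r r' : KZ.IntegralRep 3), r.domain = P → EqOn r.integrand (KZ.hypDensity 2) P → r'.domain = P' →
      EqOn r'.integrand (KZ.hypDensity 2) P' → r.value = r'.value →
      KZ.of r - KZ.of r' ∈ KZ.relations ⊔ AddSubgroup.closure {d : KZ.FormalRep | ∃ ρ : ℂ → KZ.IntegralRep 3,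
          (∀ z, IsAlgebraic ℚ z → 0 < z.im → (ρ z).domain = T z ∧
            Set.EqOn (ρ z).integrand (fun p => 1 / p 2 ^ 3) (T z)) ∧
          ∃ (k : ℕ) (z : Fin k → ℂ) (n : Fin k → ℤ), (∀ i, IsAlgebraic ℚ (z i)) ∧ (∀ i, 0 < (z i).im) ∧
            ∑ i, (n i : ℝ) * (ρ (z i)).value = 0 ∧ d = ∑ i, n i • KZ.of (ρ (z i))} := by
  intro T hT P P' hP hP' r r' hr hri hr' hri' hval
  classical
  by_cases hPP : P = P'
  · subst hPP
    exact AddSubgroup.mem_sup_left (KZ.of_sub_of_mem_relations_of_eqOn (hr'.trans hr.symm) fun p hp => by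
      rw [hri (hr ▸ hp), hri' (hr ▸ hp)])
  obtain ⟨ρ₁, hρ₁⟩ := exists_isLadderFamily 2
  set ρ : Set (Fin 3 → ℝ) → KZ.IntegralRep 3 := fun S => if S = P then r else if S = P' then r' else ρ₁ S with hρ
  have hρP : ρ P = r := by simp [hρ]
  have hρP' : ρ P' = r' := by simp [hρ, Ne.symm hPP]
  have hfam : KZ.IsLadderFamily 2 ρ := by
    intro S hS
    by_cases h1 : S = P
    · subst h1; rw [hρP]; exact ⟨hr, hri⟩
    by_cases h2 : S = P'
    · subst h2; rw [hρP']; exact ⟨hr', hri'⟩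
    simp only [hρ, if_neg h1, if_neg h2]
    exact hρ₁ S hS
  have hmem : (∑ i : Fin 2, (![1, -1] : Fin 2 → ℤ) i • KZ.of (ρ ((![P, P'] : Fin 2 → Set (Fin 3 → ℝ)) i))) ∈
      KZ.rungRelators 2 := by
    refine ⟨ρ, hfam, 2, ![P, P'], ![1, -1], fun i => ?_, ?_, rfl⟩
    · fin_cases i
      · simpa using hP
      · simpa using hP'
    · simp [Fin.sum_univ_two, hρP, hρP', hval]
  have h := rungTwo_le T hT (AddSubgroup.subset_closure hmem)
  simpa [Fin.sum_univ_two, hρP, hρP', sub_eq_add_neg] using h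


end Summit.KontsevichZagierPeriods.HyperbolicBloch.OffTetraSectorKernel

end
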